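import Summits.QuantumFields.YangMills.Theorems.BalabanUVNodesK0Stub1H128OfFlatSocket
import Literature.MathematicalPhysics.QuantumFieldTheory.Balaban1983to89.B9AdOrthogonal
import Summits.QuantumFields.YangMills.Theorems.BalabanUVNodesK0Stub1RealityFromCertificate
import Summits.QuantumFields.YangMills.Theorems.BalabanUVNodesK0Stub1V0Reality
import Summits.QuantumFields.YangMills.Theorems.BalabanUVNodesK0Stub1FlatChartStar
import HarnessLib

/-!
# K0⁷ STUB 1 (`stub_prop8StepCoP13` ∕ V20-G `stub_prop8StepCoPG13`), sub-targets S4b → S4a junction: **THE (S)-W → A₁-LINE ROWS** — the three displayed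
# hypotheses `hWq` ((98)-row), `hWA` (skew-Hermitian values), `hWtr` (traceless values) of dag-k0-s1-w1's A₁ line
# ✓`K0Stub1Letters10OnA1.exists_letters10On_A1_closed_of_adm22_T4` for THE CURRENT OF THE ♭ ROAD: dag-k0-s1-w1's normalisation (bus 2026-08-28 14:46Z, CLAIM-4
# `…K0Stub1H128OfFlatSocket`) `W_A₁ Y := (i·c²·η^d·η⁻¹)•(W_S((iη)⁻¹•Y))♮`, `Z♮ := Z − (N⁻¹·tr Z)•1`, of Sect. F's current `W_S` at instance (S)
# (dag-k0-s1-w2's D‴ ∕ p642782 `exists_sectF_W_flatScaled_atRecord_socket`), discharged at every admissible family of the record's four-tori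

Cell `pub-ymgap`, seat `pub-ymgap-k0-s1-w4` g3 (CLAIM-1, bus 2026-08-28 14:49Z). `--kind proof --supports stmt-QuantumFields-20541 --as helper`; count-neutral; def-free. [15] = [Balaban1985Variational]; [B7] = [Balaban1985Averaging].

WHY.  After dag-k0-s1-w2's ♭ socket (p642356 ∕ p642782) and dag-k0-s1-w1's `h128` junction, the A₁ line at the ♭ road still displays the three letters of its current
`W`: Prop. 4's slot `hWq` (`w₃‖W Y‖ ≤ C₄r²` on a two-size window), `hWA` (`(W X)ᴴ = −W X`) and `hWtr` (`tr W X = 0`) for `𝔰𝔲(N)`-valued `X`.  Sect. F's current at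
instance (S) is the `BE`-GRADIENT `W_S = ∇V` of the (80)∕(157) functional on COMPLEX fields; D‴ displays the reality of the implicit ♭ chart only on `herm0`
(Hermitian-TRACELESS) fields, so p604050's `herm_of_certificate` (which tests ALL Hermitian directions) does not apply to its ∃-bound `Dsel`, and indeed `W_S` HAS a
`𝟙`-component (the functional is not invariant under `A′_b ↦ A′_b + c𝟙`).  LOCATED-TRACE-PART (this seat, bus 14:39Z; adopted by dag-k0-s1-w1): the `𝟙`-part is
invisible to `𝔰𝔲(N)`-valued tests (`h128` pairs against traceless `δ`), so the A₁ line's current is the TRACELESS PROJECTION, Hermitian from the `herm0`-line reality ALONE.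

WHAT IS PROVED (sorry-free; no definition; axioms standard).
* §1 (matrix algebra on `M_N(ℂ)`, `N ≥ 1`): `trace_tracelessPart`, `inv_mul_trace_eq_ntr`, `norm_tracelessPart_le` (`‖Z♮‖ ≤ 2‖Z‖`, [B7] (20)), `tracelessPart_mem_herm0_of_isHermitian`,
  `trace_tracelessPart_mul` (`tr(Z♮δ) = tr(Zδ♮)`), ★ `isHermitian_tracelessPart_of_trace_pair_real_herm0` — `(Σ_i tr(W_i δ_i)).im = 0` for every `herm0`-valued `δ` ⇒ every
  `W_i♮` is Hermitian (p604050 `conjTranspose_eq_of_trace_pair_real_herm` applied to the traceless parts), `conjTranspose_smul_of_star_eq_neg`, `star_kappa`, `norm_kappa`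
  (`κ = i·c²·η^d·η⁻¹`: `star κ = −κ`, `‖κ‖ = c²η^dη⁻¹`), `norm_inv_I_eta_smul` (the Hermitian letter `(iη)⁻¹•X` is dag-k0-s1-w1's ✓`inv_I_eta_smul_mem_herm0`).
* §2 (reality of the (80)∕(157) functional along `herm0` lines, generic `P`): `im_pairB_eq_zero`, `ntr_letters`, `isSelfAdjoint_smul_realKernelC` (the scaled multiplier
  `η^d•M♭`), `isSelfAdjoint_fderiv_chartLogFlat_zero` (`Qlin♭`), ★ `im_V80_eq_zero_herm0`, `isOpen_w1Ball`, ★ `hreal_V80_herm0`, ★★ `im_sum_trace_current_eq_zero_of_certificate_herm0`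
  (D‴'s certificate `HasFDerivAt V (BE (W_S A′)) A′` + (27) `BE = bondPair η d ntr` + p604050 `im_eq_zero_of_hasFDerivAt_of_real_along` ⇒ `(Σ_b tr(W_S A′ b·δ b)).im = 0`, `δ` herm0).
* §3 (the rows, generic `P`, dag-k0-s1-w1's spelling of `W_A₁` VERBATIM): ★★ `trace_flatCurrentA1` (`hWtr`), `hermLetter_mem_window`, ★★ `conjTranspose_flatCurrentA1_eq_neg` (`hWA` at every
  `𝔰𝔲(N)`-valued `X` of rows `≤ ρ < η·ε`), ★★ `row98_flatCurrentA1` (`hWq` on `r < η·ε` with constant `2·(c²η^dη⁻¹)·η⁻²·C₄`); AT THE RECORD (p642782 + rows, ONE `obtain`): companion file `…K0Stub1FlatCurrentA1LineRowsAtRecord`.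
HONEST SCOPE.  Matrix algebra, first-order calculus and bookkeeping over files cited BY NAME (p642782, p604050, dag-k0-s1-w4 p633473 ∕ p635978); the (98) row, the
(157) certificate and the chart's reality are CONSUMED from p642782; NO estimate of [15]∕[B7] is proved or asserted here; `h128`, the sizes `h1 h2`, the slice (153) and the
S6 budget stay with their owners; `stub_prop8StepCoP13` ∕ `stub_prop8StepCoPG13` ∕ K0⁷ NOT closed (ONE PEN: not this seat); N07 NOT discharged; no summit statement is proved by
this seat; counts unmoved (28∕28 · 5∕27); one finite 𝕋⁴ programme at fixed ε — R4 closes the conditional finite-𝕋⁴ rung `BalabanLadder.UV` only, never the summit; the YM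
mass gap (Clay) is NOT proved by any of this; nothing continuum ∕ ℝ⁴ ∕ OS.  No `sorry`, no `def`, no `instance`, no `notation`.

References: [15] (22) p.281, (26)–(27) p.282, (48) p.285, (63) p.287, (66) p.288, (80) p.290, Prop. 4 (97)–(98) pp.292–293, Prop. 6 p.295, (127)–(128) p.297, (152) p.301, (156)–(158) p.302; [B7] (17) p.20, (20) p.21.
-/

set_option autoImplicit false

noncomputable section

open scoped BigOperators Matrix Matrix.Norms.L2Operator Topology InnerProductSpace RealInnerProductSpace ContDiff
open Filter

namespace Summit.QuantumFields.YangMills.Theorems.K0Stub1FlatCurrentA1LineRows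

open Literature.MathematicalPhysics.QuantumFieldTheory.Balaban1983to89
open T4AdjointCovarianceUnitary (lieSU mem_lieSU_iff)
open B9AdOrthogonal (herm0 mem_herm0)
open MatrixNorms (ntr)
open Summit.QuantumFields.YangMills.Theorems.K0Stub1RealityFromCertificate (conjTranspose_eq_of_trace_pair_real_herm
  im_eq_zero_of_hasFDerivAt_of_real_along)
open Summit.QuantumFields.YangMills.Theorems.K0Stub1H128OfFlatSocket (inv_I_eta_smul_mem_herm0)

/-! ## §1  The traceless part of a matrix: trace, norm, reality from `herm0`-tests -/

section TracelessPart

variable {N : ℕ} [NeZero N]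

/-- The traceless part `Z − (N⁻¹·tr Z)•1` is traceless. [folklore] -/
theorem trace_tracelessPart (Z : Matrix (Fin N) (Fin N) ℂ) :
    (Z - (((N : ℂ))⁻¹ * Z.trace) • (1 : Matrix (Fin N) (Fin N) ℂ)).trace = 0 := by
  rw [Matrix.trace_sub, Matrix.trace_smul, Matrix.trace_one, Fintype.card_fin, smul_eq_mul, mul_right_comm,
    inv_mul_cancel₀ (Nat.cast_ne_zero.2 (NeZero.ne N)), one_mul, sub_self]

omit [NeZero N] in
/-- `N⁻¹·tr Z` is the normalised trace `ntr Z`. [cite: Balaban1985Averaging, (17) p.20] -/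
theorem inv_mul_trace_eq_ntr (Z : Matrix (Fin N) (Fin N) ℂ) : ((N : ℂ))⁻¹ * Z.trace = ntr Z := by
  rw [MatrixNorms.ntr, Fintype.card_fin, div_eq_inv_mul]

/-- `‖Z − (N⁻¹·tr Z)•1‖ ≤ 2‖Z‖` in the operator norm (`|tr Z| ≤ N‖Z‖`, [B7] (20)). [cite: Balaban1985Averaging, (20) p.21] -/
theorem norm_tracelessPart_le (Z : Matrix (Fin N) (Fin N) ℂ) :
    ‖Z - (((N : ℂ))⁻¹ * Z.trace) • (1 : Matrix (Fin N) (Fin N) ℂ)‖ ≤ 2 * ‖Z‖ := by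
  have h1 : ‖(((N : ℂ))⁻¹ * Z.trace) • (1 : Matrix (Fin N) (Fin N) ℂ)‖ ≤ ‖Z‖ := by
    rw [norm_smul, norm_one, mul_one, inv_mul_trace_eq_ntr]
    exact MatrixNorms.norm_ntr_le_opNorm Z
  calc ‖Z - (((N : ℂ))⁻¹ * Z.trace) • (1 : Matrix (Fin N) (Fin N) ℂ)‖
        ≤ ‖Z‖ + ‖(((N : ℂ))⁻¹ * Z.trace) • (1 : Matrix (Fin N) (Fin N) ℂ)‖ := norm_sub_le _ _
    _ ≤ ‖Z‖ + ‖Z‖ := by gcongr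
    _ = 2 * ‖Z‖ := by ring

/-- The traceless part of a HERMITIAN matrix is Hermitian-traceless (`tr T` is real). [folklore] -/
theorem tracelessPart_mem_herm0_of_isHermitian {T : Matrix (Fin N) (Fin N) ℂ} (hT : T.IsHermitian) :
    T - (((N : ℂ))⁻¹ * T.trace) • (1 : Matrix (Fin N) (Fin N) ℂ) ∈ herm0 (Fin N) := by
  refine mem_herm0.2 ⟨?_, trace_tracelessPart T⟩
  have htr : star T.trace = T.trace := by rw [← Matrix.trace_conjTranspose, hT.eq]
  have hm : star (((N : ℂ))⁻¹ * T.trace) = ((N : ℂ))⁻¹ * T.trace := by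
    rw [star_mul', htr, star_inv₀, star_natCast]
  unfold Matrix.IsHermitian
  rw [Matrix.conjTranspose_sub, Matrix.conjTranspose_smul, Matrix.conjTranspose_one, hm, hT.eq]

omit [NeZero N] in
/-- Pairing bookkeeping: against the decomposition `δ = δ♮ + (N⁻¹tr δ)•1`, the traceless part `Z♮` pairs as `tr(Z♮·δ) = tr(Z·δ♮)`. [folklore] -/
theorem trace_tracelessPart_mul (Z δ : Matrix (Fin N) (Fin N) ℂ) :
    ((Z - (((N : ℂ))⁻¹ * Z.trace) • (1 : Matrix (Fin N) (Fin N) ℂ)) * δ).trace =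
      (Z * (δ - (((N : ℂ))⁻¹ * δ.trace) • (1 : Matrix (Fin N) (Fin N) ℂ))).trace := by
  rw [Matrix.sub_mul, Matrix.mul_sub, Matrix.smul_mul, Matrix.mul_smul, Matrix.one_mul, Matrix.mul_one, Matrix.trace_sub, Matrix.trace_sub,
    Matrix.trace_smul, Matrix.trace_smul, smul_eq_mul, smul_eq_mul]
  ring

/-- ★ **PAIRED REAL AGAINST EVERY HERMITIAN-TRACELESS FAMILY ⇒ THE TRACELESS PARTS ARE HERMITIAN** (dag-k0-s1-w4 LOCATED-TRACE-PART (ii)): if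
`(Σ_i tr(W_i δ_i)).im = 0` for every `herm0`-valued `δ`, then every `W_i − (N⁻¹tr W_i)•1` is Hermitian (the `𝟙`-component of `W_i` may be any
complex number — it is invisible to traceless tests).  Proof: the traceless parts pair real against EVERY Hermitian family (`tr(W♮δ) = tr(Wδ♮)`, `δ♮`
Hermitian-traceless), so p604050's `conjTranspose_eq_of_trace_pair_real_herm` applies to them. [cite: Balaban1985Variational, (27) p.282, Prop. 4 p.292] -/
theorem isHermitian_tracelessPart_of_trace_pair_real_herm0 {ι : Type*} [Fintype ι] [DecidableEq ι] (W : ι → Matrix (Fin N) (Fin N) ℂ)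
    (h : ∀ δ : ι → Matrix (Fin N) (Fin N) ℂ, (∀ i, δ i ∈ herm0 (Fin N)) → (∑ i, (W i * δ i).trace).im = 0) (i₀ : ι) :
    (W i₀ - (((N : ℂ))⁻¹ * (W i₀).trace) • (1 : Matrix (Fin N) (Fin N) ℂ)).IsHermitian := by
  refine conjTranspose_eq_of_trace_pair_real_herm (fun i => W i - (((N : ℂ))⁻¹ * (W i).trace) • (1 : Matrix (Fin N) (Fin N) ℂ)) (fun δ hδ => ?_) i₀
  have hre : ∑ i, ((W i - (((N : ℂ))⁻¹ * (W i).trace) • (1 : Matrix (Fin N) (Fin N) ℂ)) * δ i).trace =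
      ∑ i, (W i * (δ i - (((N : ℂ))⁻¹ * (δ i).trace) • (1 : Matrix (Fin N) (Fin N) ℂ))).trace :=
    Finset.sum_congr rfl fun i _ => trace_tracelessPart_mul (W i) (δ i)
  rw [hre]
  exact h _ fun i => tracelessPart_mem_herm0_of_isHermitian (hδ i)

omit [NeZero N] in
/-- An imaginary multiple of a Hermitian matrix is skew-Hermitian: `((i·r)•H)ᴴ = −(i·r)•H` for `star κ = −κ`. [folklore] -/
theorem conjTranspose_smul_of_star_eq_neg {κ : ℂ} (hκ : star κ = -κ) {H : Matrix (Fin N) (Fin N) ℂ} (hH : H.IsHermitian) :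
    (κ • H)ᴴ = -(κ • H) := by
  rw [Matrix.conjTranspose_smul, hκ, hH.eq, neg_smul]

/-- The A₁ line's scalar `κ = i·c²·η^d·η⁻¹` (dag-k0-s1-w1 CLAIM-4) is imaginary: `star κ = −κ`. [cite: Balaban1985Variational, (27) p.282, (156) p.302] -/
theorem star_kappa (c η : ℝ) (d : ℕ) :
    star (Complex.I * (c : ℂ) ^ 2 * (η : ℂ) ^ d * ((η : ℂ))⁻¹) = -(Complex.I * (c : ℂ) ^ 2 * (η : ℂ) ^ d * ((η : ℂ))⁻¹) := by
  rw [Complex.star_def, map_mul, map_mul, map_mul, map_inv₀, map_pow, map_pow, Complex.conj_I, Complex.conj_ofReal, Complex.conj_ofReal]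
  ring

/-- `‖κ‖ = c²·η^d·η⁻¹` for `0 < η`. [cite: Balaban1985Variational, (27) p.282] -/
theorem norm_kappa (c : ℝ) {η : ℝ} (hη : 0 < η) (d : ℕ) :
    ‖Complex.I * (c : ℂ) ^ 2 * (η : ℂ) ^ d * ((η : ℂ))⁻¹‖ = c ^ 2 * η ^ d * η⁻¹ := by
  rw [norm_mul, norm_mul, norm_mul, Complex.norm_I, one_mul, norm_inv, norm_pow, norm_pow, Complex.norm_real, Complex.norm_real,
    Real.norm_eq_abs, Real.norm_eq_abs, abs_of_pos hη, sq_abs]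

omit [NeZero N] in
/-- norms of the Hermitian letter: `‖(iη)⁻¹•Y‖ = η⁻¹‖Y‖` (`0 < η`). [folklore] -/
theorem norm_inv_I_eta_smul {η : ℝ} (hη : 0 < η) (Y : Matrix (Fin N) (Fin N) ℂ) :
    ‖(Complex.I * (η : ℂ))⁻¹ • Y‖ = η⁻¹ * ‖Y‖ := by
  rw [norm_smul, norm_inv, norm_mul, Complex.norm_I, one_mul, Complex.norm_real, Real.norm_eq_abs, abs_of_pos hη]

end TracelessPart


/-! ## §2  Reality of Sect. F's (80)∕(157) functional along Hermitian-traceless lines ⇒ the current pairs real against `herm0` tests -/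

section Reality

variable {P : Params} {N : ℕ}

/-- `B X Y = Σ_t τ(X_t Y_t)` is real on Hermitian families (tracial `τ` commuting with `star`). [cite: Balaban1985Variational, (27) p.282, (66) p.288] -/
theorem im_pairB_eq_zero {κ : Type*} [Fintype κ] (τ : Matrix (Fin N) (Fin N) ℂ →ₗ[ℂ] ℂ)
    (hτ : ∀ a b : Matrix (Fin N) (Fin N) ℂ, τ (a * b) = τ (b * a)) (hτs : ∀ a : Matrix (Fin N) (Fin N) ℂ, τ (star a) = starRingEnd ℂ (τ a))
    {X Y : κ → Matrix (Fin N) (Fin N) ℂ} (hX : ∀ c, IsSelfAdjoint (X c)) (hY : ∀ c, IsSelfAdjoint (Y c)) :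
    (∑ c, τ (X c * Y c)).im = 0 := by
  refine Complex.conj_eq_iff_im.1 ?_
  rw [map_sum]
  refine Finset.sum_congr rfl fun c _ => ?_
  rw [← hτs, star_mul, (hX c).star_eq, (hY c).star_eq, hτ]

/-- The normalised trace is tracial and commutes with `star` (the two letters of `τ = ntr` that D‴ does not re-export). [cite: Balaban1985Averaging, (17) p.20] -/
theorem ntr_letters (τ : Matrix (Fin N) (Fin N) ℂ →L[ℂ] ℂ) (hntr : ∀ X, τ X = ntr X) :
    (∀ a b : Matrix (Fin N) (Fin N) ℂ, τ (a * b) = τ (b * a)) ∧ (∀ a : Matrix (Fin N) (Fin N) ℂ, τ (star a) = starRingEnd ℂ (τ a)) := by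
  refine ⟨fun a b => ?_, fun a => ?_⟩
  · rw [hntr, hntr, MatrixNorms.ntr, MatrixNorms.ntr, Matrix.trace_mul_comm]
  · rw [hntr, hntr, MatrixNorms.ntr, MatrixNorms.ntr, Matrix.star_eq_conjTranspose, Matrix.trace_conjTranspose, Complex.star_def, map_div₀,
      map_natCast]

/-- A complex-cast real kernel, scaled by a real scalar (`conj z = z`), maps Hermitian families to Hermitian families (the SCALED multiplier `η^d•M♭` of D‴).
[cite: Balaban1985Variational, (134) p.298; Balaban1984PropagatorsII, (2.35) p.228] -/
theorem isSelfAdjoint_smul_realKernelC {ι κ : Type*} [Fintype κ] (M : (κ → Matrix (Fin N) (Fin N) ℂ) →L[ℂ] (ι → Matrix (Fin N) (Fin N) ℂ))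
    (m : ι → κ → ℝ) (hM : ∀ X t, M X t = ∑ s, ((m t s : ℝ) : ℂ) • X s) {z : ℂ} (hz : starRingEnd ℂ z = z) {X : κ → Matrix (Fin N) (Fin N) ℂ}
    (hX : ∀ s, IsSelfAdjoint (X s)) (t : ι) : IsSelfAdjoint ((z • M) X t) := by
  have hXs : (fun s => star (X s)) = X := funext fun s => (hX s).star_eq
  show star (z • M X t) = z • M X t
  rw [star_smul, Complex.star_def, hz, K0Stub1FlatChartStar.star_apply_of_realKernelC M m hM X t, hXs]

/-- The ♭ linearisation `Qlin♭ = D(chartLogFlat)(0)` maps Hermitian fields to Hermitian data (dag-k0-s1-w4 `fderiv_chartLogFlat_zero_star`). [cite: Balaban1985Variational, (48) p.285] -/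
theorem isSelfAdjoint_fderiv_chartLogFlat_zero (η : ℝ) (D : B6SectADomainsV1.Domains P) {A : PBond P 0 → Matrix (Fin N) (Fin N) ℂ}
    (hA : ∀ b, IsSelfAdjoint (A b)) (idx : B6SectAOperatorsV1.BondIdx D) :
    IsSelfAdjoint (fderiv ℂ (Prop8ChartDoubleBar.chartLogFlat η D : (PBond P 0 → Matrix (Fin N) (Fin N) ℂ) → B6SectAOperatorsV1.BondIdx D → Matrix (Fin N) (Fin N) ℂ) 0 A idx) := by
  have hAs : (fun b => star (A b)) = A := funext fun b => (hA b).star_eq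
  show star _ = _
  rw [← K0Stub1FlatChartStar.fderiv_chartLogFlat_zero_star, hAs]

/-- ★ **SECT. F's (80)∕(157) FUNCTIONAL IS REAL AT HERMITIAN-TRACELESS POINTS OF THE `ε`-BALL** — `½B(Dsel A, M Dsel A) − B(Q A, M Dsel A) + V₀(A − H Dsel A)` with
`B = Σ_t τ` (tracial `τ` commuting with `star`), `M` and `Q` Hermitian-preserving, the implicit ♭ chart's reality on `herm0` (D‴'s displayed conjunct: `Dsel A` and
`A − H(Dsel A)` Hermitian-traceless for Hermitian-traceless `A` in the ball) and pv27's `V₀` real on the group (dag-k0-s1-w4 `V0_im_eq_zero`).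
[cite: Balaban1985Variational, (26)-(27) p.282, (80) p.290, (157) p.302] -/
theorem im_V80_eq_zero_herm0 {κ : Type*} [Fintype κ] (k : ℕ) {w : ℕ → PBond P 0 → ℝ} {ε : ℝ}
    (τ : Matrix (Fin N) (Fin N) ℂ →L[ℂ] ℂ)
    (hτ : ∀ a b : Matrix (Fin N) (Fin N) ℂ, τ (a * b) = τ (b * a)) (hτs : ∀ a : Matrix (Fin N) (Fin N) ℂ, τ (star a) = starRingEnd ℂ (τ a))
    (B : (κ → Matrix (Fin N) (Fin N) ℂ) →L[ℂ] (κ → Matrix (Fin N) (Fin N) ℂ) →L[ℂ] ℂ)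
    (hB : ∀ X X' : κ → Matrix (Fin N) (Fin N) ℂ, B X X' = ∑ t, τ (X t * X' t))
    (H : (κ → Matrix (Fin N) (Fin N) ℂ) →ₗ[ℂ] (PBond P 0 → Matrix (Fin N) (Fin N) ℂ))
    (M : (κ → Matrix (Fin N) (Fin N) ℂ) →L[ℂ] (κ → Matrix (Fin N) (Fin N) ℂ))
    (hMsa : ∀ X : κ → Matrix (Fin N) (Fin N) ℂ, (∀ c, IsSelfAdjoint (X c)) → ∀ c, IsSelfAdjoint (M X c))
    (Q : (PBond P 0 → Matrix (Fin N) (Fin N) ℂ) →L[ℂ] (κ → Matrix (Fin N) (Fin N) ℂ))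
    (hQsa : ∀ A : PBond P 0 → Matrix (Fin N) (Fin N) ℂ, (∀ b, IsSelfAdjoint (A b)) → ∀ c, IsSelfAdjoint (Q A c))
    (Dsel : (PBond P 0 → Matrix (Fin N) (Fin N) ℂ) → (κ → Matrix (Fin N) (Fin N) ℂ))
    (hDsa : ∀ A : PBond P 0 → Matrix (Fin N) (Fin N) ℂ, (∀ b, w 1 b * ‖A b‖ < ε) → (∀ b, A b ∈ herm0 (Fin N)) →
      (∀ c, Dsel A c ∈ herm0 (Fin N)) ∧ ∀ b, (A - H (Dsel A)) b ∈ herm0 (Fin N))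
    {A : PBond P 0 → Matrix (Fin N) (Fin N) ℂ} (hA : ∀ b, w 1 b * ‖A b‖ < ε) (hAh : ∀ b, A b ∈ herm0 (Fin N)) :
    (2⁻¹ * B (Dsel A) (M (Dsel A)) - B (Q A) (M (Dsel A))
      + B11Eq26ActionExpansion.V0 (LatticeFieldCalculus.shiftEquiv (P := P) (j := 0)) (fun _ _ => (1 : (Matrix (Fin N) (Fin N) ℂ)ˣ)) (((P.L : ℝ)⁻¹) ^ k) P.d
          (τ : Matrix (Fin N) (Fin N) ℂ →ₗ[ℂ] ℂ) (fun μ x => (A - H (Dsel A)) ⟨x, μ⟩)).im = 0 := by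
  obtain ⟨hD, hΦ⟩ := hDsa A hA hAh
  have hD' : ∀ c, IsSelfAdjoint (Dsel A c) := fun c => (mem_herm0.1 (hD c)).1
  have hA' : ∀ b, IsSelfAdjoint (A b) := fun b => (mem_herm0.1 (hAh b)).1
  have hM := hMsa _ hD'
  have h1 : (B (Dsel A) (M (Dsel A))).im = 0 := by
    rw [hB]; exact im_pairB_eq_zero (τ : Matrix (Fin N) (Fin N) ℂ →ₗ[ℂ] ℂ) hτ hτs hD' hM
  have h2 : (B (Q A) (M (Dsel A))).im = 0 := by
    rw [hB]; exact im_pairB_eq_zero (τ : Matrix (Fin N) (Fin N) ℂ →ₗ[ℂ] ℂ) hτ hτs (hQsa A hA') hM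
  have h3 := K0Stub1V0Reality.V0_im_eq_zero (LatticeFieldCalculus.shiftEquiv (P := P) (j := 0)) (fun _ _ => (1 : (Matrix (Fin N) (Fin N) ℂ)ˣ))
    (fun _ _ => by rw [inv_one, Units.val_one, star_one]) (τ : Matrix (Fin N) (Fin N) ℂ →ₗ[ℂ] ℂ) hτ hτs (((P.L : ℝ)⁻¹) ^ k) P.d
    (A := fun μ x => (A - H (Dsel A)) ⟨x, μ⟩) (fun μ x => (mem_herm0.1 (hΦ ⟨x, μ⟩)).1.eq)
  rw [Complex.add_im, Complex.sub_im, h2, h3, Complex.mul_im, h1]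
  simp

/-- The `w₁`-weighted ball is open (finitely many strict inequalities). [folklore] -/
theorem isOpen_w1Ball (w : ℕ → PBond P 0 → ℝ) (ε : ℝ) : IsOpen {Y : PBond P 0 → Matrix (Fin N) (Fin N) ℂ | ∀ b, w 1 b * ‖Y b‖ < ε} := by
  rw [Set.setOf_forall]
  exact isOpen_iInter_of_finite fun b => isOpen_lt (continuous_const.mul (continuous_apply b).norm) continuous_const

/-- ★ **`hreal` ALONG HERMITIAN-TRACELESS LINES**: at a Hermitian-traceless `A` in the open `w₁`-ball and along every Hermitian-traceless direction `δ`,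
`V(A + tδ)` is real for real `t` near `0` (`A + tδ` stays in the ball and in `herm0`). [cite: Balaban1985Variational, (63) p.287, (80) p.290, (157) p.302] -/
theorem hreal_V80_herm0 {κ : Type*} [Fintype κ] (k : ℕ) {w : ℕ → PBond P 0 → ℝ} {ε : ℝ}
    (τ : Matrix (Fin N) (Fin N) ℂ →L[ℂ] ℂ)
    (hτ : ∀ a b : Matrix (Fin N) (Fin N) ℂ, τ (a * b) = τ (b * a)) (hτs : ∀ a : Matrix (Fin N) (Fin N) ℂ, τ (star a) = starRingEnd ℂ (τ a))
    (B : (κ → Matrix (Fin N) (Fin N) ℂ) →L[ℂ] (κ → Matrix (Fin N) (Fin N) ℂ) →L[ℂ] ℂ)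
    (hB : ∀ X X' : κ → Matrix (Fin N) (Fin N) ℂ, B X X' = ∑ t, τ (X t * X' t))
    (H : (κ → Matrix (Fin N) (Fin N) ℂ) →ₗ[ℂ] (PBond P 0 → Matrix (Fin N) (Fin N) ℂ))
    (M : (κ → Matrix (Fin N) (Fin N) ℂ) →L[ℂ] (κ → Matrix (Fin N) (Fin N) ℂ))
    (hMsa : ∀ X : κ → Matrix (Fin N) (Fin N) ℂ, (∀ c, IsSelfAdjoint (X c)) → ∀ c, IsSelfAdjoint (M X c))
    (Q : (PBond P 0 → Matrix (Fin N) (Fin N) ℂ) →L[ℂ] (κ → Matrix (Fin N) (Fin N) ℂ))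
    (hQsa : ∀ A : PBond P 0 → Matrix (Fin N) (Fin N) ℂ, (∀ b, IsSelfAdjoint (A b)) → ∀ c, IsSelfAdjoint (Q A c))
    (Dsel : (PBond P 0 → Matrix (Fin N) (Fin N) ℂ) → (κ → Matrix (Fin N) (Fin N) ℂ))
    (hDsa : ∀ A : PBond P 0 → Matrix (Fin N) (Fin N) ℂ, (∀ b, w 1 b * ‖A b‖ < ε) → (∀ b, A b ∈ herm0 (Fin N)) →
      (∀ c, Dsel A c ∈ herm0 (Fin N)) ∧ ∀ b, (A - H (Dsel A)) b ∈ herm0 (Fin N))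
    {A : PBond P 0 → Matrix (Fin N) (Fin N) ℂ} (hA : ∀ b, w 1 b * ‖A b‖ < ε) (hAh : ∀ b, A b ∈ herm0 (Fin N))
    (δ : PBond P 0 → Matrix (Fin N) (Fin N) ℂ) (hδ : ∀ b, δ b ∈ herm0 (Fin N)) :
    ∀ᶠ t : ℝ in 𝓝 0, ((fun A : PBond P 0 → Matrix (Fin N) (Fin N) ℂ => 2⁻¹ * B (Dsel A) (M (Dsel A)) - B (Q A) (M (Dsel A))
      + B11Eq26ActionExpansion.V0 (LatticeFieldCalculus.shiftEquiv (P := P) (j := 0)) (fun _ _ => (1 : (Matrix (Fin N) (Fin N) ℂ)ˣ)) (((P.L : ℝ)⁻¹) ^ k) P.d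
          (τ : Matrix (Fin N) (Fin N) ℂ →ₗ[ℂ] ℂ) (fun μ x => (A - H (Dsel A)) ⟨x, μ⟩)) (A + (t : ℂ) • δ)).im = 0 := by
  have hcont : Continuous fun t : ℝ => A + (t : ℂ) • δ := continuous_const.add (Complex.continuous_ofReal.smul continuous_const)
  have hmem : ∀ᶠ t : ℝ in 𝓝 0, (A + (t : ℂ) • δ) ∈ {Y : PBond P 0 → Matrix (Fin N) (Fin N) ℂ | ∀ b, w 1 b * ‖Y b‖ < ε} := by
    refine hcont.continuousAt.preimage_mem_nhds ((isOpen_w1Ball (N := N) w ε).mem_nhds ?_)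
    show (A + ((0 : ℝ) : ℂ) • δ) ∈ {Y : PBond P 0 → Matrix (Fin N) (Fin N) ℂ | ∀ b, w 1 b * ‖Y b‖ < ε}
    rw [Complex.ofReal_zero, zero_smul, add_zero]
    exact hA
  filter_upwards [hmem] with t ht
  refine im_V80_eq_zero_herm0 k τ hτ hτs B hB H M hMsa Q hQsa Dsel hDsa ht fun b => ?_
  rw [Pi.add_apply, Pi.smul_apply, Complex.coe_smul]
  exact (herm0 (Fin N)).add_mem (hAh b) ((herm0 (Fin N)).smul_mem t (hδ b))

variable [NeZero N]

/-- ★★ **THE CURRENT PAIRS REAL AGAINST EVERY HERMITIAN-TRACELESS TEST** — from D‴'s certificate `HasFDerivAt V (BE (W_S A)) A` ((157) at instance (S), print's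
(80)), the (27) pairing `BE = bondPair η d τ` with `τ = ntr`, and §2's reality of `V` along `herm0` lines through `A` (p604050 `im_eq_zero_of_hasFDerivAt_of_real_along`):
`(Σ_b tr(W_S A b · δ b)).im = 0` for every `herm0`-valued `δ`. [cite: Balaban1985Variational, (27) p.282, (63) p.287, (80) p.290, Prop. 4 p.292, (157)-(158) p.302] -/
theorem im_sum_trace_current_eq_zero_of_certificate_herm0 {η : ℝ} (hη : η ≠ 0) (τ : Matrix (Fin N) (Fin N) ℂ →L[ℂ] ℂ) (hntr : ∀ X, τ X = ntr X)
    (BE : (PBond P 0 → Matrix (Fin N) (Fin N) ℂ) →L[ℂ] (PBond P 0 → Matrix (Fin N) (Fin N) ℂ) →L[ℂ] ℂ)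
    (hBE : ∀ Y δ : PBond P 0 → Matrix (Fin N) (Fin N) ℂ, BE Y δ =
      B9Eq39Adjoint.bondPair η P.d (τ : Matrix (Fin N) (Fin N) ℂ →ₗ[ℂ] ℂ) (fun μ x => Y ⟨x, μ⟩) (fun μ x => δ ⟨x, μ⟩))
    (V : (PBond P 0 → Matrix (Fin N) (Fin N) ℂ) → ℂ) {A : PBond P 0 → Matrix (Fin N) (Fin N) ℂ} {WSA : PBond P 0 → Matrix (Fin N) (Fin N) ℂ}
    (hcert : HasFDerivAt V (BE WSA) A)
    (hreal : ∀ δ : PBond P 0 → Matrix (Fin N) (Fin N) ℂ, (∀ b, δ b ∈ herm0 (Fin N)) → ∀ᶠ t : ℝ in 𝓝 0, (V (A + (t : ℂ) • δ)).im = 0)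
    (δ : PBond P 0 → Matrix (Fin N) (Fin N) ℂ) (hδ : ∀ b, δ b ∈ herm0 (Fin N)) :
    (∑ b, (WSA b * δ b).trace).im = 0 := by
  have h := im_eq_zero_of_hasFDerivAt_of_real_along V hcert (hreal δ hδ)
  have hN0 : (N : ℂ) ≠ 0 := Nat.cast_ne_zero.2 (NeZero.ne N)
  -- `BE W δ = (η^d ∕ N)·Σ_b tr(W_b δ_b)`
  have hsum : BE WSA δ = (((η ^ P.d * (N : ℝ)⁻¹ : ℝ)) : ℂ) * ∑ b, (WSA b * δ b).trace := by
    rw [hBE, K0Stub1PairingsAtExtensions.bondPair_PBond_eq_sum, Finset.mul_sum, Finset.mul_sum]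
    refine Finset.sum_congr rfl fun b _ => ?_
    rw [ContinuousLinearMap.coe_coe, hntr, MatrixNorms.ntr, Fintype.card_fin]
    push_cast
    field_simp
  rw [hsum, Complex.im_ofReal_mul] at h
  rcases mul_eq_zero.1 h with h0 | h0
  · exfalso
    exact (mul_ne_zero (pow_ne_zero _ hη) (inv_ne_zero (Nat.cast_ne_zero.2 (NeZero.ne N)))) h0
  · exact h0

end Reality


/-! ## §3  The A₁ line's current `W_A₁ Y := (i·c²·η^d·η⁻¹)•(W_S((iη)⁻¹•Y))♮` (dag-k0-s1-w1's normalisation): the three rows `hWtr`, `hWA`, `hWq` -/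

section Rows

variable {P : Params} {N : ℕ} [NeZero N]

/-- ★★ **`hWtr`**: the A₁ line's current is traceless — by construction (traceless projection). [cite: Balaban1985Variational, (22) p.281, (158) p.302] -/
theorem trace_flatCurrentA1 (η c : ℝ) (W : (PBond P 0 → Matrix (Fin N) (Fin N) ℂ) → (PBond P 0 → Matrix (Fin N) (Fin N) ℂ))
    (Y : PBond P 0 → Matrix (Fin N) (Fin N) ℂ) (j : PBond P 0) :
    ((Complex.I * (c : ℂ) ^ 2 * (η : ℂ) ^ P.d * ((η : ℂ))⁻¹) •
      (W (fun b => (Complex.I * (η : ℂ))⁻¹ • Y b) j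
        - (((N : ℂ))⁻¹ * (W (fun b => (Complex.I * (η : ℂ))⁻¹ • Y b) j).trace) • (1 : Matrix (Fin N) (Fin N) ℂ))).trace = 0 := by
  rw [Matrix.trace_smul, trace_tracelessPart, smul_zero]

omit [NeZero N] in
/-- the Hermitian letter of a small `𝔰𝔲(N)`-field lies in the two-size window: `w₁‖(iη)⁻¹X‖ ≤ η⁻¹ρ < ε` and the same for the gradient row (`ρ < η·ε`). [cite: Balaban1985Variational, (152) p.301, (156) p.302] -/
theorem hermLetter_mem_window {η ε Λ ρ : ℝ} (hη : 0 < η) (w : ℕ → PBond P 0 → ℝ) (X : PBond P 0 → Matrix (Fin N) (Fin N) ℂ) (hρ : ρ < η * ε)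
    (h1 : ∀ b, w 1 b * ‖X b‖ ≤ ρ) (h2 : ∀ (b : PBond P 0) (ν : Fin P.d), w 2 b * Λ * ‖X ⟨b.src.shift ν, b.dir⟩ - X b‖ ≤ ρ) :
    (∀ b, w 1 b * ‖(Complex.I * (η : ℂ))⁻¹ • X b‖ < ε) ∧
      ∀ (b : PBond P 0) (ν : Fin P.d), w 2 b * Λ * ‖(Complex.I * (η : ℂ))⁻¹ • X ⟨b.src.shift ν, b.dir⟩ - (Complex.I * (η : ℂ))⁻¹ • X b‖ < ε := by
  have hρ' : η⁻¹ * ρ < ε := by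
    rw [inv_mul_lt_iff₀ hη]; exact hρ
  refine ⟨fun b => ?_, fun b ν => ?_⟩
  · rw [norm_inv_I_eta_smul hη, mul_left_comm]
    exact (mul_le_mul_of_nonneg_left (h1 b) (inv_nonneg.2 hη.le)).trans_lt hρ'
  · rw [← smul_sub, norm_inv_I_eta_smul hη, mul_left_comm (w 2 b * Λ)]
    exact (mul_le_mul_of_nonneg_left (h2 b ν) (inv_nonneg.2 hη.le)).trans_lt hρ'

/-- ★★ **`hWA`**: at an `𝔰𝔲(N)`-valued `X` whose Hermitian letter `A′ = (iη)⁻¹•X` lies in the two-size `ε`-window (`ρ < η·ε`), the A₁ line's current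
`(i·c²·η^d·η⁻¹)•(W_S A′)♮` is SKEW-HERMITIAN — from the `herm0`-line reality of the current (`hWreal`, §2's output at every Hermitian-traceless point of the window),
§1's `isHermitian_tracelessPart_of_trace_pair_real_herm0`, and `star κ = −κ`. [cite: Balaban1985Variational, (22) p.281, Prop. 4 p.292, Prop. 6 p.295, (156)-(158) p.302] -/
theorem conjTranspose_flatCurrentA1_eq_neg (η c : ℝ) (hη : 0 < η) {ε Λ : ℝ} (w : ℕ → PBond P 0 → ℝ)
    (W : (PBond P 0 → Matrix (Fin N) (Fin N) ℂ) → (PBond P 0 → Matrix (Fin N) (Fin N) ℂ))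
    (hWreal : ∀ A' : PBond P 0 → Matrix (Fin N) (Fin N) ℂ, (∀ b, w 1 b * ‖A' b‖ < ε) →
      (∀ (b : PBond P 0) (ν : Fin P.d), w 2 b * Λ * ‖A' ⟨b.src.shift ν, b.dir⟩ - A' b‖ < ε) → (∀ b, A' b ∈ herm0 (Fin N)) →
      ∀ δ : PBond P 0 → Matrix (Fin N) (Fin N) ℂ, (∀ b, δ b ∈ herm0 (Fin N)) → (∑ b, (W A' b * δ b).trace).im = 0)
    (X : PBond P 0 → lieSU (Fin N)) {ρ : ℝ} (hρ : ρ < η * ε) (h1 : ∀ b, w 1 b * ‖((X b : lieSU (Fin N)) : Matrix (Fin N) (Fin N) ℂ)‖ ≤ ρ)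
    (h2 : ∀ (b : PBond P 0) (ν : Fin P.d),
      w 2 b * Λ * ‖((X ⟨b.src.shift ν, b.dir⟩ : lieSU (Fin N)) : Matrix (Fin N) (Fin N) ℂ) - ((X b : lieSU (Fin N)) : Matrix (Fin N) (Fin N) ℂ)‖ ≤ ρ)
    (j : PBond P 0) :
    ((Complex.I * (c : ℂ) ^ 2 * (η : ℂ) ^ P.d * ((η : ℂ))⁻¹) •
      (W (fun b => (Complex.I * (η : ℂ))⁻¹ • ((X b : lieSU (Fin N)) : Matrix (Fin N) (Fin N) ℂ)) j
        - (((N : ℂ))⁻¹ * (W (fun b => (Complex.I * (η : ℂ))⁻¹ • ((X b : lieSU (Fin N)) : Matrix (Fin N) (Fin N) ℂ)) j).trace) •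
          (1 : Matrix (Fin N) (Fin N) ℂ)))ᴴ =
    -((Complex.I * (c : ℂ) ^ 2 * (η : ℂ) ^ P.d * ((η : ℂ))⁻¹) •
      (W (fun b => (Complex.I * (η : ℂ))⁻¹ • ((X b : lieSU (Fin N)) : Matrix (Fin N) (Fin N) ℂ)) j
        - (((N : ℂ))⁻¹ * (W (fun b => (Complex.I * (η : ℂ))⁻¹ • ((X b : lieSU (Fin N)) : Matrix (Fin N) (Fin N) ℂ)) j).trace) •
          (1 : Matrix (Fin N) (Fin N) ℂ))) := by
  obtain ⟨hw1, hw2⟩ := hermLetter_mem_window hη w (fun b => ((X b : lieSU (Fin N)) : Matrix (Fin N) (Fin N) ℂ)) hρ h1 h2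
  have hh : ∀ b, (Complex.I * (η : ℂ))⁻¹ • ((X b : lieSU (Fin N)) : Matrix (Fin N) (Fin N) ℂ) ∈ herm0 (Fin N) :=
    fun b => inv_I_eta_smul_mem_herm0 (X b).2
  exact conjTranspose_smul_of_star_eq_neg (star_kappa c η P.d)
    (isHermitian_tracelessPart_of_trace_pair_real_herm0 _ (hWreal _ hw1 hw2 hh) j)

/-- ★★ **`hWq`**: the (98)-row of the A₁ line's current — from D‴'s (98) row for `W_S` on the two-size `ε`-window: on the window `r < η·ε`,
`w₃(b)‖W_A₁ Y b‖ ≤ (2·(c²η^dη⁻¹)·η⁻²·C₄)·r²` (`‖(iη)⁻¹Y‖ = η⁻¹‖Y‖`, `‖Z♮‖ ≤ 2‖Z‖`, `‖κ‖ = c²η^dη⁻¹`). [cite: Balaban1985Variational, Prop. 4 (97)-(98) pp.292-293, (158) p.302] -/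
theorem row98_flatCurrentA1 (η c : ℝ) (hη : 0 < η) {ε C₄ Λ : ℝ} (w : ℕ → PBond P 0 → ℝ) (hw3 : ∀ b, 0 ≤ w 3 b)
    (W : (PBond P 0 → Matrix (Fin N) (Fin N) ℂ) → (PBond P 0 → Matrix (Fin N) (Fin N) ℂ))
    (h98 : ∀ (Y : PBond P 0 → Matrix (Fin N) (Fin N) ℂ) (r : ℝ), r < ε → (∀ b, w 1 b * ‖Y b‖ ≤ r) →
      (∀ (b : PBond P 0) (ν : Fin P.d), w 2 b * Λ * ‖Y ⟨b.src.shift ν, b.dir⟩ - Y b‖ ≤ r) → ∀ b, w 3 b * ‖W Y b‖ ≤ C₄ * r ^ 2)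
    (Y : PBond P 0 → Matrix (Fin N) (Fin N) ℂ) (r : ℝ) (hr : r < η * ε) (h1 : ∀ b, w 1 b * ‖Y b‖ ≤ r)
    (h2 : ∀ (b : PBond P 0) (ν : Fin P.d), w 2 b * Λ * ‖Y ⟨b.src.shift ν, b.dir⟩ - Y b‖ ≤ r) (b : PBond P 0) :
    w 3 b * ‖(Complex.I * (c : ℂ) ^ 2 * (η : ℂ) ^ P.d * ((η : ℂ))⁻¹) •
      (W (fun b' => (Complex.I * (η : ℂ))⁻¹ • Y b') b
        - (((N : ℂ))⁻¹ * (W (fun b' => (Complex.I * (η : ℂ))⁻¹ • Y b') b).trace) • (1 : Matrix (Fin N) (Fin N) ℂ))‖ ≤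
      (2 * (c ^ 2 * η ^ P.d * η⁻¹) * η⁻¹ ^ 2 * C₄) * r ^ 2 := by
  -- the Hermitian letter `Y′ = (iη)⁻¹•Y` has rows `≤ η⁻¹r < ε`
  have hr' : η⁻¹ * r < ε := by rw [inv_mul_lt_iff₀ hη]; exact hr
  have h1' : ∀ b', w 1 b' * ‖(Complex.I * (η : ℂ))⁻¹ • Y b'‖ ≤ η⁻¹ * r := fun b' => by
    rw [norm_inv_I_eta_smul hη, mul_left_comm]
    exact mul_le_mul_of_nonneg_left (h1 b') (inv_nonneg.2 hη.le)
  have h2' : ∀ (b' : PBond P 0) (ν : Fin P.d),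
      w 2 b' * Λ * ‖(Complex.I * (η : ℂ))⁻¹ • Y ⟨b'.src.shift ν, b'.dir⟩ - (Complex.I * (η : ℂ))⁻¹ • Y b'‖ ≤ η⁻¹ * r := fun b' ν => by
    rw [← smul_sub, norm_inv_I_eta_smul hη, mul_left_comm (w 2 b' * Λ)]
    exact mul_le_mul_of_nonneg_left (h2 b' ν) (inv_nonneg.2 hη.le)
  have hW := h98 _ _ hr' h1' h2' b
  set Z := W (fun b' => (Complex.I * (η : ℂ))⁻¹ • Y b') b with hZ
  have hκ := norm_kappa c hη P.d
  calc w 3 b * ‖(Complex.I * (c : ℂ) ^ 2 * (η : ℂ) ^ P.d * ((η : ℂ))⁻¹) • (Z - (((N : ℂ))⁻¹ * Z.trace) • (1 : Matrix (Fin N) (Fin N) ℂ))‖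
        = (c ^ 2 * η ^ P.d * η⁻¹) * (w 3 b * ‖Z - (((N : ℂ))⁻¹ * Z.trace) • (1 : Matrix (Fin N) (Fin N) ℂ)‖) := by
          rw [norm_smul, hκ]; ring
    _ ≤ (c ^ 2 * η ^ P.d * η⁻¹) * (w 3 b * (2 * ‖Z‖)) := by
          gcongr
          · exact hw3 b
          · exact norm_tracelessPart_le Z
    _ = 2 * (c ^ 2 * η ^ P.d * η⁻¹) * (w 3 b * ‖Z‖) := by ring
    _ ≤ 2 * (c ^ 2 * η ^ P.d * η⁻¹) * (C₄ * (η⁻¹ * r) ^ 2) := by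
          gcongr
    _ = (2 * (c ^ 2 * η ^ P.d * η⁻¹) * η⁻¹ ^ 2 * C₄) * r ^ 2 := by ring

end Rows


end Summit.QuantumFields.YangMills.Theorems.K0Stub1FlatCurrentA1LineRows

end
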